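import Summits.BirchSwinnertonDyer.Rank1Residual.O5.HeegnerIndexThree
import Summits.BirchSwinnertonDyer.Rank1Residual.X11b.AnticyclotomicEmbedding
import Summits.BirchSwinnertonDyer.Rank1Residual.X11b.AnticyclotomicControlMap
import Summits.BirchSwinnertonDyer.Rank1Residual.O5.O5KummerLine
import Summits.BirchSwinnertonDyer.Rank1Residual.X11b.BDPRouteLocalIndexTorsion
import Summits.BirchSwinnertonDyer.Rank1Residual.Additive.LocalLogImageRat
import HarnessLib
import HarnessLib.Audit.Tags

/-!
# Heegner-log transport across the additive/good divide at `p = 3` (KL3) — o5-r2 GEN 16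

TEAM O5 (tame potentially-supersingular additive `p = 3`, cell (t′): `9 ‖ N`), planner 2 (non-Iwasawa
side: Heegner/Kolyvagin at additive 3). Unit `b2b-bsdres-o5-r2-g16` (planner-b2b-bsdres-o5-r2-g16-0,
2026-08-22). Companion files: `O5/HeegnerIndexThree.lean` (target T-O5-B `O5HeegnerIndexThree`),
`O5/JochnowitzAtThree.lean`, `O5/O5OldLine.lean` (companions prime to 3), `O5/O5CompanionTransport.lean`
(T14/T15: the CYCLOTOMIC λ-transport; this file is the ANTICYCLOTOMIC / Heegner-log side),
`X11b/AnticyclotomicEmbedding.lean` (`padicLogOrd`: `ord_p log_{ω_E} P` on tree objects).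

HONEST FRAMING: every node below is a `def … : Prop` — a THEOREM-CANDIDATE with its printed source
(§2: Kriz–Li) or an OPEN statement / conjecture node (§3, §4); NOTHING is asserted, nothing is booked,
no RESIDUAL-MAP mark moves. The one theorem proved here (§3, `o5HeegnerUnitIndexThree_of_heegnerIndex`)
is bookkeeping: the KL3 target is a WEAKENING of T-O5-B. Census support: C-KL3-V (o5-r2 GEN 16,
`b2b-bsdres-o5-r2/gen16/kl3/`, pre-registered before the job id) — EVIDENCE only.

## The lever (KL3)

Kriz–Li (*Goldfeld's conjecture and congruences between Heegner points*, Forum Math. Sigma 7 (2019)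
e15, Thm. 1.16; GL₂-type version Thm. 3.9; arXiv:1606.03172): for `E, E′/ℚ` of conductors `N, N′` with
`E[p^m]^{ss} ≅ E′[p^m]^{ss}`, `K` Heegner for both, `p` split in `K`,
`(∏_{ℓ ∣ pNN′/M} |Ẽ^{ns}(𝔽_ℓ)|/ℓ)·log_{ω_E} P ≡ ± (∏_{ℓ ∣ pNN′/M} |Ẽ′^{ns}(𝔽_ℓ)|/ℓ)·log_{ω_{E′}} P′ (mod p^m)`,
`M = ∏_{ℓ ∣ (N,N′), a_ℓ(E) ≡ a_ℓ(E′) (p^m)} ℓ^{ord_ℓ(NN′)}`, both sides `p`-integral (Remark 3.10), and —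
decisive here — "we do not require E to have good reduction at p" (§1.6). For a (t′) curve (`9 ‖ N`,
additive at 3) the factor at `ℓ = p = 3` is `|Ẽ^{ns}(𝔽_3)|/3 = 3/3 = 1` and the 3-stabilisation
`f^{(3)} = f` is trivial (`a_3 = 0`), so the congruence with a companion PRIME TO 3 (or multiplicative
at 3) is NON-degenerate: the unit/non-unit bit of the normalised 3-adic Heegner logarithm crosses the
additive/good divide. (This corrects the remark E-O5-J-d in the docstring of
`JochnowitzAtThree.HeegnerBitSharedByCompanions`, which called that congruence degenerate — ERRATUM
E-KL3, docstring only.) The proof is direct 3-adic integration on `X₀` + the `q`-expansion principle: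
NO multiplicity one, NO Gorenstein property, NO comparison of periods — exactly the inputs that fail
or are unavailable at `9 ‖ N` for the Brandt-module (Jochnowitz/Bertolini–Darmon) and Mazur–Tate
(Greenberg–Vatsal/EPW, T13 `DepletedCongruenceLawThree`) transports.

## The chain (memo `gen16/KL3-DERIVATION.md`)
(i) every Kodaira-III* (t′) curve has a weight-2 companion newform `g` of level prime to 3
(`O5OldLine`: `PeuRamifieCompanionLawThree`, THEOREM-CANDIDATE); (ii) §2 below transports the unit bit
of `u·log P` between `E` and `A_g`; (iii) the relaxed/strict residual Selmer groups
`Sel_{∅,0}(K, E[3])` and `Sel_{∅,0}(K, A_g[λ])` coincide (same `ρ̄`; the local conditions above 3 are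
"everything / nothing", blind to the reduction type — Galois cohomology, theorem-grade); (iv) the
Poitou–Tate COUNT §2b (`O5BaseSelmerCountThree`, KL3-B, THEOREM-CANDIDATE on the tree's own
`X11b.AcSelmer.selmerAcBase`: `#Sel_𝔭(K, W[3^∞]) = 3^a`, `a = ord₃ #Ш(W/K)[3^∞] + 2(ord₃ log_ω P −
ord₃ [W(K):ℤP])` — JSW17 Prop. 3.2.1's shape with the local index at the additive prime recomputed, no
"−1" — with the kernel-checked consequence `selmerAcBase_card_eq_one_of_units`), the MATCHING §2c
(`ResidualSelmerMatchingThree`, KL3-M, THEOREM-CANDIDATE: under `H⁰(ℚ_v, ρ̄) = 0` at `v = 3` and at the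
primes of `N_W N_G` the two base Selmer groups are trivial together — step (iii) on tree objects) and the
companion-side input §4 (`GoodHeegnerLogUnitThree`: at GOOD `p = 3`, `Sel_{∅,0} = 0 ⇒` normalised
Heegner log is a unit — the lower inclusion of the Heegner-point / BDP main conjecture at `p = 3`; in
print for `p > 3` only: the "only missing ingredient" at `p = 3` is X. Wan's divisibility, which assumes
`p > 3` for a comparison of automorphic periods — Burungale–Castella–Skinner, arXiv:2405.00270, p. 5);
(v) ⇒ §3 (`O5HeegnerUnitIndexThree`): on the T-O5-B class, `Ш(E/K)[3] = 0` (+ 3-adic units: Tamagawa,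
Manin, depletion factors, a 3-primitive generator) forces `3 ∤ [E(K) : ℤ P_K]` — bit 1 of the LOWER
half of T-O5-B, the half no Kolyvagin-side argument gives. With a `3^m`-congruent companion the first
`m` bits transport; generically `m = 1` (honest scope).

ASSEMBLY-TODO (successor, A-KL3-asm): the kernel-checked composition KL3-A → KL3-B → KL3-M → (JSW count for the
GOOD companion, `X11b.BaseSelmerCountAt`-shape, theorem in print) → KL3-D → KL3-C♭ needed three formal lemmas not
then in the tree — (L1) `padicLogOrd W 3 ι (n • Q) = v₃(n) + padicLogOrd W 3 ι Q` (formal-group logarithm is a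
homomorphism; reduces "log P unit" to "3 ∤ [W(K):ℤP] ∧ generator depth 0"), (L2) `klExponent W G = 0` from the
unit hypotheses (a `Finset` computation over `klSet`), (L3) `ι₃ = embAt K 3 𝔭 …` bookkeeping — and is NOT
claimed here; the nodes are typed so that each step is a separate, citable obligation. DONE IN THIS FILE:
(L2) = §2d (`klExponent_eq_zero_of_units`, `nsCount_three_of_additive`) and the LOG STEP = §2e
(`padicLogOrd_eq_zero_of_companion_unit` : KL3-A + companion-side unit ⇒ `ord₃ log_{ω_W} P_W = 0`,
sorry-free modulo the hypothesis KL3-A); (L1) = §2f, PROVED on X11b's local-index machinery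
(`BDPRouteLocalIndexTorsion`: the `ℤ₃`-coordinate `Ψ(P_ι)` has valuation `padicLogOrd + ord₃ c₃ + ord₃ #Ẽ_ns(𝔽₃) − 1`,
`= padicLogOrd` at an additive prime with unit `c₃`; `padicPointOf_ne_nsmul_of_padicLogOrd_eq_zero`,
`not_nsmul_eq_of_padicLogOrd_eq_zero_of_addv`, `padicValNat_index_zmultiples_eq_zero` (Cauchy in the finite
quotient, needs `E(K)[3] = 0`), `padicValNat_index_eq_zero_of_padicLogOrd_eq_zero`) and composed with the log step
in §2g (`padicValNat_index_eq_zero_of_companion_unit` : KL3-A + companion-side unit + explicit 3-unit side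
conditions ⇒ `ord₃ [W(K) : ℤP] = 0`); what remains for KL3-C♭ is (L3) (`ι₃ = embAt`; `P_{ι₃}` of infinite order from `P` is
`not_isOfFinAddOrder_padicPointOf`), the link local `c₃` ↔ `3 ∤ tamagawaProduct`, `W(K)[3] = 0` from mod-3
surjectivity, and the Selmer steps KL3-B/M feeding KL3-D's `Ш(G/K)[3^∞] = 0` input on the COMPANION side.

Sources: [KrizLi2019] D. Kriz, C. Li, Forum Math. Sigma 7 (2019) e15, Thm. 1.16, Thm. 3.9, Rem. 3.10,
§1.6 (arXiv:1606.03172); [BCS2024] A. Burungale, F. Castella, C. Skinner, arXiv:2405.00270, p. 5 and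
Thm. 4.2.1; [GrossLMS1991] B. Gross, *Kolyvagin's work on modular elliptic curves*, LMS LN 153, Conj. 1.2;
[BDP2013] M. Bertolini, H. Darmon, K. Prasanna, Duke Math. J. 162 (2013) Thm. 5.13 (the `p`-adic
Waldspurger formula: `L_p^{BDP}(1) ≐ ((1 − a_p + p)/p)² · log²_{ω} P_K`); [Castella2018] F. Castella,
Math. Ann. (arXiv:1704.06608) §2.2 (the normalisation of `log_{ω_E}` = tree `padicLogOrd`).

TYPER PLACEMENT NOTE (cc-typer-5 GEN 17 = O5 §3.5 / O6 §3.4 typer of record; ask A-O5-G16-1 of o5-r2 GEN 16 AS AMENDED, HOME/INBOX.md l.13154 /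
l.13174 ('v7 … is this seat's FILE OF RECORD; please place'); docket cc-lead ⟦gen68⟧/⟦gen69⟧ (2′) (c31)).  Source: `HOME/b2b-bsdres-o5-r2/gen16/lean/HeegnerLogTransportThree.lean` v7, sha16 `38be72b6cc6441f0` (701 l.; o5-r2 GEN 16's FILE OF RECORD, HOME/INBOX.md l.13174),
re-hashed by the typer right before writing (o5-r2's own `lean check` rc 0 19:57Z; the typer's farm check of the source and of the split rc 0);
memo `gen16/KL3-DERIVATION.md`; census C-KL3-V `gen16/kl3/KL3-RESULT.md` 49a9a5ad19824453 (CALIBRATION PASS: P-KL3-1 / P-KL3-2 870/870, 0 exceptions;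
census-lead GEN 29 concurs) — EVIDENCE only.  PLACEMENT = the source VERBATIM, split in THREE files for `lint.size` (≤ 400 l.; §1–§2g alone is
431 l., so no two-file cut keeps both halves under the cap with room for later restamps): THIS file = the module text + §1–§2d (vocabulary `nsCount` /
`klSet` / `klExponent`; KL3-A `KrizLiUnitBitTransportThree` / KL3-A′ `KrizLiIntegralityThree` = Kriz–Li Thm. 1.16 / Rem. 3.10 restated as plain
`def … : Prop` THEOREM-CANDIDATES, consumed only as hypotheses `(hA : …)` — no Literature fact is minted by this lane; KL3-B
`O5BaseSelmerCountThree`, KL3-M `ResidualSelmerMatchingThree` (THEOREM-CANDIDATES, hypotheses only); the PROVED bookkeeping L2);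
`O5/HeegnerLogTransportThreeChain.lean` = §2e–§2g (PROVED modulo the binder `hA`: the log step, L1 at an additive prime, the composed W-side);
`O5/HeegnerLogTransportThreeTargets.lean` = §3–§5 (the `@[conjecture]` nodes KL3-C `O5HeegnerUnitIndexThree`, KL3-D `GoodHeegnerLogUnitThree`,
KL3-C♭ `O5HeegnerUnitIndexFromCompanionThree` + the two PROVED ladder lemmas; §5 KL3-E stays PROSE, as the source has it).  Every declaration
block is byte-identical to the source; `@[conjecture]` × 0 here and in the Chain file, × 3 in the Targets file (= the source's three); 0 Literature
facts; no `sorry`.  HONEST FRAMING (cell `b2b-bsdres`): research route, lane CLASS-CLOSURE §3.5 O5; nothing asserted, nothing booked, no mark of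
`RESIDUAL-MAP.md` moves; census = EVIDENCE, never a Literature fact; O5 OPEN.  ERRATUM E-KL3 of `O5/JochnowitzAtThree.lean` (remark E-O5-J-d) is
the separate docstring-only touch (c29).

RESTAMP ⟦cc-typer-5 GEN 18, 2026-08-23T04:54Z, DOC-ONLY restamp⟧ (statement bytes of every declaration unchanged; docstring text only): KL3-A `KrizLiUnitBitTransportThree` ↦
THEOREM modulo {A314 `KrizLi2019.thm116_padicLogHeegner_congruence`, modularity} (part 14 `O5/HeegnerLogTransportThreeKrizLiGlue.lean`, p352538);
KL3-B `O5BaseSelmerCountThree` ↦ THEOREM modulo the displayed textbook facts (part 11b `O5/HeegnerLogTransportThreeBaseSelmerCount.lean`, p352220);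
KL3-M: its degree-one form `ResidualSelmerMatchingThreeDegOne` is PROVED in `O5/HeegnerLogTransportThreeResidual.lean` (p348865); KL3-A′
`KrizLiIntegralityThree` unchanged (not consumed).  Nothing booked; no mark of `RESIDUAL-MAP.md` moves; O5 OPEN.
-/

noncomputable section

open scoped Classical

open WeierstrassCurve Literature.NumberTheory.EllipticCurves
  Literature.NumberTheory.EllipticCurves.ModularForms
  Literature.NumberTheory.EllipticCurves.Rank1Residual
  Literature.NumberTheory.EllipticCurves.Rank1Residual.Typed

namespace Summit.BirchSwinnertonDyer.Rank1Residual.O5.HeegnerLogTransport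

open Summit.BirchSwinnertonDyer.Rank1Residual.X11b (padicLogOrd embAt padicPointOf)
open Summit.BirchSwinnertonDyer.Rank1Residual.X11b.LocalIndex (psi
  exists_addEquiv_valuation_psi_padicPointOf valuation_psi_zsmul_add)
open Literature.NumberTheory.EllipticCurves.Rank1Residual (Addv)
open Summit.BirchSwinnertonDyer.Rank1Residual.Additive.LocalLog (reductionPointCount_of_addv)
open Summit.BirchSwinnertonDyer.Rank1Residual.X11b.AcSelmer (selmerAcBase)
open IsDedekindDomain (HeightOneSpectrum)
open scoped NumberField

/-! ## §1 Vocabulary: non-singular point counts and Kriz–Li's depletion exponent -/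

/-- **`#Ẽ^{ns}(𝔽_ℓ)` for a globally minimal `W/ℚ`**: `ℓ + 1 − a_ℓ` (good), `ℓ − a_ℓ` (multiplicative,
`a_ℓ = ±1`), `ℓ` (additive, `a_ℓ = 0`); uniformly `ℓ + [good] − a_ℓ(W)` with `a_ℓ = W.LFunction ℓ` (the
tree's Dirichlet coefficient, `0` at additive and `±1` at multiplicative primes). [cite: KrizLi2019, Rem. 1.17]
[cite: SilvermanAEC2009, VII.2 Prop. 2.1 and Ex. 8.19] -/
def nsCount (W : WeierstrassCurve ℚ) [W.IsElliptic] (ℓ : ℕ) : ℤ :=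
  (ℓ : ℤ) + (if h : ℓ.Prime then (haveI := Fact.mk h; if W.HasGoodReductionAtPrime ℓ then 1 else 0) else 0)
    - W.LFunction ℓ

/-- **Kriz–Li's depletion set at `p = 3`, `m = 1`** for the ordered pair `(W, G)`: the primes
`ℓ ∣ 3·N_W·N_G` NOT in `M`, where `M` collects the `ℓ ∣ (N_W, N_G)` with `a_ℓ(W) ≡ a_ℓ(G) (mod 3)`;
the prime `3` itself always survives (the extra factor `p` in `pNN′/M`). [cite: KrizLi2019, Thm. 1.16 (the set `ℓ ∣ pNN′/M`)] -/
def klSet (W G : WeierstrassCurve ℚ) [W.IsElliptic] [G.IsElliptic] : Finset ℕ :=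
  (3 * W.conductorNorm ℤ * G.conductorNorm ℤ).primeFactors.filter fun ℓ =>
    ℓ = 3 ∨ ¬ (ℓ ∣ W.conductorNorm ℤ ∧ ℓ ∣ G.conductorNorm ℤ ∧
      ((W.LFunction ℓ : ℤ) : ZMod 3) = ((G.LFunction ℓ : ℤ) : ZMod 3))

/-- **`U_W = ord₃ ∏_{ℓ ∈ klSet} |W̃^{ns}(𝔽_ℓ)|/ℓ`** — the 3-adic valuation of Kriz–Li's Euler-type
factor on the `W`-side of the pair `(W, G)` (`−1` from the `/ℓ` at `ℓ = 3`; `/ℓ` is a unit for `ℓ ≠ 3`).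
For `W` additive at 3 the `ℓ = 3` term is `ord₃(3/3) = 0`; for `G` good at 3 it is
`ord₃(4 − a_3(G)) − 1 ∈ {−1, 0}`. [cite: KrizLi2019, Thm. 1.16 and Rem. 1.17] -/
def klExponent (W G : WeierstrassCurve ℚ) [W.IsElliptic] [G.IsElliptic] : ℤ :=
  ∑ ℓ ∈ klSet W G, (padicValInt 3 (nsCount W ℓ) - if ℓ = 3 then 1 else 0)

/-! ## §2 The Kriz–Li congruence at `p = 3`, valuation form (THEOREM-CANDIDATES) -/

/-- **KL3-A `KrizLiUnitBitTransportThree` (THEOREM modulo the REGISTERED Literature fact A314 + modularity — STATUS below; was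
THEOREM-CANDIDATE = Kriz–Li Thm. 1.16 at `p = 3`,
`m = 1`, read on valuations).** For globally minimal elliptic `W, G /ℚ` with `a_ℓ(W) ≡ a_ℓ(G) (mod 3)`
at every prime `ℓ ∤ 3 N_W N_G` (so `W[3]^{ss} ≅ G[3]^{ss}`, Brauer–Nesbitt–Chebotarev), parametrisation
data `D, D′` at levels `N, N′`, an imaginary quadratic `K` (discriminant `< −4`) Heegner for `N` and `N′`
with `3 ∤ d_K` and an embedding `ι₃ : K →+* ℚ₃` (so `3` splits), Heegner points `P ∈ W(K)`, `P′ ∈ G(K)` of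
the two data (read through one complex embedding `ι`), both of infinite order:
`U_W + ord₃ log_{ω_W} P − ord₃ c_D = 0 ↔ U_G + ord₃ log_{ω_G} P′ − ord₃ c_{D′} = 0`
(`log_{ω_f} = log_{Néron}/c_D`, KL §1.4; `ord₃ log` = tree `padicLogOrd`, Castella's normalisation).
NO reduction hypothesis at 3 on either curve (KL §1.6) — the point of this file. A theorem in print;
typed here as a candidate for a `_holds` by citation. STATUS ⟦cc-typer-5 GEN 18, 2026-08-23T04:54Z, DOC-ONLY restamp⟧: PROVED from the registered
Literature fact `KrizLi2019.thm116_padicLogHeegner_congruence` (CITED-FACTS §A A314, lit GEN 90 p350088) and modularity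
`exists_isNewformOf` by o5-r2 GEN 21's part 14 `O5/HeegnerLogTransportThreeKrizLiGlue.lean` —
`krizLiUnitBitTransportThree_of_thm116` / `krizLiUnitBitTransportThree_of_thm116_of_exists_isNewformOf` (p352538 ACCEPTED
9d3861ce972a); this node stays a plain `def … : Prop` consumed as `(hA : …)` (part 15 `…CitedEnd.lean` re-displays the END with
`hKL : KrizLi2019.thm116_padicLogHeegner_congruence` instead); statement bytes unchanged. [cite: KrizLi2019, Thm. 1.16, Rem. 3.10, §1.6]
[cite: Castella2018, §2.2] -/
def KrizLiUnitBitTransportThree : Prop :=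
  ∀ (W G : WeierstrassCurve ℚ) [W.IsElliptic] [W.IsGloballyMinimal] [G.IsElliptic] [G.IsGloballyMinimal],
    (∀ ℓ : ℕ, ℓ.Prime → ¬ (ℓ ∣ 3 * W.conductorNorm ℤ * G.conductorNorm ℤ) →
      ((W.LFunction ℓ : ℤ) : ZMod 3) = ((G.LFunction ℓ : ℤ) : ZMod 3)) →
  ∀ {N N' : ℕ} [NeZero N] [NeZero N'] (D : ModularParametrizationData W N)
    (D' : ModularParametrizationData G N')
    (K : Type) [Field K] [NumberField K], IsImaginaryQuadratic K →
    SatisfiesHeegnerHypothesis N K → SatisfiesHeegnerHypothesis N' K →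
    NumberField.discr K < -4 → ¬ ((3 : ℤ) ∣ NumberField.discr K) →
  ∀ (H : HeegnerDatum N (NumberField.discr K)) (H' : HeegnerDatum N' (NumberField.discr K))
    (ι : K →+* ℂ) (ι₃ : K →+* ℚ_[3])
    (P : (W.baseChange K).toAffine.Point) (P' : (G.baseChange K).toAffine.Point),
    WeierstrassCurve.Affine.Point.map ι.toRatAlgHom P = heegnerPointComplex D H →
    WeierstrassCurve.Affine.Point.map ι.toRatAlgHom P' = heegnerPointComplex D' H' →
    ¬ IsOfFinAddOrder P → ¬ IsOfFinAddOrder P' →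
    (klExponent W G + padicLogOrd W 3 ι₃ P - padicValInt 3 D.maninConstant = 0 ↔
      klExponent G W + padicLogOrd G 3 ι₃ P' - padicValInt 3 D'.maninConstant = 0)

/-- **KL3-A′ `KrizLiIntegralityThree` (THEOREM-CANDIDATE = Kriz–Li Rem. 3.10 at `p = 3`).** In the
setting of KL3-A (one curve suffices): `U_W + ord₃ log_{ω_W} P − ord₃ c_D ≥ 0` — CM points are
integral and the rigid primitive of `ω_f^{(3NN′/M)}` has integral `q`-expansion. For `W` additive at 3
(`U`-term at 3 equal to `0`) this says nothing new when `c_D` is a 3-unit; for a companion `G`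
NON-anomalous good at 3 (`3 ∤ 4 − a_3(G)`, term `−1`) it says `3 ∣ log_{ω_G} P′`, i.e. the formal-group
fact `|G̃(𝔽_3)|·P′ ∈ Ĝ(3ℤ₃)`. Registered census prediction P-KL3-2. [cite: KrizLi2019, Rem. 3.10] -/
def KrizLiIntegralityThree : Prop :=
  ∀ (W G : WeierstrassCurve ℚ) [W.IsElliptic] [W.IsGloballyMinimal] [G.IsElliptic] [G.IsGloballyMinimal],
    (∀ ℓ : ℕ, ℓ.Prime → ¬ (ℓ ∣ 3 * W.conductorNorm ℤ * G.conductorNorm ℤ) →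
      ((W.LFunction ℓ : ℤ) : ZMod 3) = ((G.LFunction ℓ : ℤ) : ZMod 3)) →
  ∀ {N : ℕ} [NeZero N] (D : ModularParametrizationData W N)
    (K : Type) [Field K] [NumberField K], IsImaginaryQuadratic K →
    SatisfiesHeegnerHypothesis N K → NumberField.discr K < -4 → ¬ ((3 : ℤ) ∣ NumberField.discr K) →
  ∀ (H : HeegnerDatum N (NumberField.discr K)) (ι : K →+* ℂ) (ι₃ : K →+* ℚ_[3])
    (P : (W.baseChange K).toAffine.Point),
    WeierstrassCurve.Affine.Point.map ι.toRatAlgHom P = heegnerPointComplex D H →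
    ¬ IsOfFinAddOrder P →
    0 ≤ klExponent W G + padicLogOrd W 3 ι₃ P - padicValInt 3 D.maninConstant

/-! ## §2b KL3-B — chain step (iv): the Poitou–Tate COUNT of Castella's base Selmer group at an ADDITIVE (t′) `3`

The transport (ii)–(iii) of `KL3-DERIVATION.md` §3 lands in the RESIDUAL-Selmer / strict-relaxed Selmer group
over `K`; what turns "that Selmer group vanishes" into "`Ш[3] = 0` and the Heegner log has the valuation of the
index" is a Poitou–Tate COUNT. The tree already has the object and the count SHAPE at a good / multiplicative
`p`: `X11b.AcSelmer.selmerAcBase (W.baseChange K) p 𝔭 ∅ = Sel_𝔭(K, E[p^∞])` (strict at `𝔭`, relaxed at `𝔭̄`,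
trivial away from `p`; Cas18 Def. 2.2 at level `K`) and `X11b.BaseSelmerCountAt` = JSW17 Prop. 3.2.1 / (7.1.5),
`a = ord_p #Ш(E/K)[p^∞] + 2((ord_p log_ω P − 1) − ord_p [E(K):ℤP]) + ord_p ∏_{w∣p} c_w`. At a (t′) prime the
LOCAL term changes and nothing else: for `W` of Kodaira type III / III* at `3` with `W(ℚ₃)[3] = 0`
(`NoLocalThreeTorsionAt`, measured on all of O5 by o5-r1's C-A3) one has `#W̃_ns(𝔽₃) = 3`, `c₃ = 2`,
`E⁰(ℚ₃) ≅ ℤ₃ ⊇ E₁(ℚ₃) = 3·E⁰(ℚ₃)` (a torsion-free pro-3 group containing `Ê(3ℤ₃) ≅ 3ℤ₃` with index 3), hence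
`log_ω(E(ℚ₃) ⊗ ℤ₃) = ℤ₃`: the `δ`-term is `ord₃ log_ω P − ord₃ [E(K):ℤP]` WITHOUT JSW's "−1" (their "−1" is
`ord_p` of `#Ẽ(𝔽_p)/p`-free formal index at a non-anomalous good `p`; Kriz–Li's factor `|W̃_ns(𝔽₃)|/3 = 1` is the
same bookkeeping), and the Tamagawa term above `3` is `ord₃(c₃²) = 0`. This is the precise form of
`KL3-DERIVATION.md` §3(iv): `Sel_𝔭(K, W[3^∞]) = 0 ⟺ Ш(W/K)[3^∞] = 0 ∧ ord₃ log_ω P = ord₃ [W(K):ℤP]`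
(both summands being `≥ 0`: the second is `ord₃ log_ω` of a generator modulo torsion, integral because
`log_ω(E(ℚ₃) ⊗ ℤ₃) = ℤ₃`). -/

/-- **KL3-B `O5BaseSelmerCountThree` (THEOREM modulo the displayed textbook facts — STATUS below; was THEOREM-CANDIDATE;
global duality exactly as JSW17 Prop. 3.2.1, with the
local index at the additive prime recomputed as in the section docstring; NOT in print at an additive prime;
consumed as a hypothesis, never a named fact).** For every O5 curve `W` ((t′): additive potentially
supersingular at `3`, `9 ‖ N`) with surjective mod-3 image and `W(ℚ₃)[3] = 0`, every Heegner datum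
(`K` Heegner for the level, `d_K < −4`, Heegner point `P ∈ W(K)` of infinite order — so `rank W(K) = 1` and
`Ш(W/K)` is finite by Gross–Zagier–Kolyvagin) and every degree-one prime `𝔭 ∣ 3` of `K` (it exists: `3 ∣ N`
splits in `K`): Castella's base Selmer group `Sel_𝔭(K, W[3^∞])` is finite of order `3^a` with
`a = ord₃ #Ш(W/K)[3^∞] + 2 (ord₃ log_ω P − ord₃ [W(K) : ℤP])`, the logarithm read along THE embedding
`K ↪ K_𝔭 = ℚ₃` (`X11b.embAt`). STATUS ⟦cc-typer-5 GEN 18, 2026-08-23T04:54Z, DOC-ONLY restamp⟧: PROVED from the displayed textbook facts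
(`poitouTate_selmerStructure_duality`, `localEulerPoincareCharacteristic`, `kolyvagin` — hypotheses BY NAME, no fact minted) by
o5-r2 GEN 21's part 11b `O5/HeegnerLogTransportThreeBaseSelmerCount.lean` — `o5BaseSelmerCountThree_of_facts (hPT) (hEP) (hKo) :
O5BaseSelmerCountThree` (p352220 ACCEPTED bf5b1b409088; on parts 8 / 10a / 10b / 11a p349318 / p349954 / p350559 / p350983); this node
stays a plain `def … : Prop` consumed as `(hB : …)`; statement bytes unchanged.
[cite: JetchevSkinnerWan2017, Prop. 3.2.1 and (7.1.5) (arXiv:1512.06894 pp. 10–11, 16) (shape at good p; the additive-3 local term is this file's)]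
[cite: Castella2018, Def. 2.2 and Thm. 2.3 (arXiv:1704.06608 p. 5) (the Selmer group)] -/
def O5BaseSelmerCountThree : Prop :=
  ∀ (W : WeierstrassCurve ℚ) [W.IsElliptic] [W.IsGloballyMinimal],
    Addv W 3 → 0 ≤ padicValRat 3 W.j → Additive.CondExpTwo W 3 →
    W.HasSurjectiveModNGaloisRep 3 → NoLocalThreeTorsionAt W 3 →
    ∀ {N : ℕ} [NeZero N] (D : ModularParametrizationData W N) (K : Type) [Field K] [NumberField K],
      IsImaginaryQuadratic K → SatisfiesHeegnerHypothesis N K → NumberField.discr K < -4 →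
      ∀ (H : HeegnerDatum N (NumberField.discr K)) (ι : K →+* ℂ) (P : (W.baseChange K).toAffine.Point),
        WeierstrassCurve.Affine.Point.map ι.toRatAlgHom P = heegnerPointComplex D H → ¬ IsOfFinAddOrder P →
        ∀ (𝔭 : HeightOneSpectrum (𝓞 K)) (h𝔭 : ((3 : ℕ) : 𝓞 K) ∈ 𝔭.asIdeal)
          (he : 𝔭.asIdeal.ramificationIdx (𝓞 ℚ) = 1) (hf : 𝔭.asIdeal.inertiaDeg (𝓞 ℚ) = 1),
          ∃ a : ℕ, (∃ _ : Finite (selmerAcBase (W.baseChange K) 3 𝔭 ∅),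
              Nat.card (selmerAcBase (W.baseChange K) 3 𝔭 ∅) = 3 ^ a) ∧
            (a : ℤ) = (padicValNat 3 (Nat.card (AddCommGroup.primaryComponent (W.baseChange K).sha 3)) : ℤ) +
              2 * (padicLogOrd W 3 (embAt K 3 𝔭 h𝔭 he hf) P -
                (padicValNat 3 (AddSubgroup.zmultiples P).index : ℤ))

/-- **The direction the KL3 chain consumes, kernel-checked bookkeeping**: under the count KL3-B, at any O5
Heegner datum where `Ш(W/K)[3^∞]` is trivial and the Heegner logarithm has EXACTLY the valuation of the index
(`ord₃ log_ω P = ord₃ [W(K):ℤP]`, i.e. a generator's normalised log is a 3-adic unit), Castella's base Selmer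
group `Sel_𝔭(K, W[3^∞])` is trivial. (The converse — `Sel = 0 ⇒` both — additionally needs the integrality
`ord₃ log_ω P ≥ ord₃ [W(K):ℤP]`, KL3-A′-type, and is left as prose.) [this file: bookkeeping] -/
theorem selmerAcBase_card_eq_one_of_units (h : O5BaseSelmerCountThree)
    (W : WeierstrassCurve ℚ) [W.IsElliptic] [W.IsGloballyMinimal]
    (hA : Addv W 3) (hj : 0 ≤ padicValRat 3 W.j) (hf₂ : Additive.CondExpTwo W 3)
    (hs : W.HasSurjectiveModNGaloisRep 3) (ht : NoLocalThreeTorsionAt W 3)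
    {N : ℕ} [NeZero N] (D : ModularParametrizationData W N) (K : Type) [Field K] [NumberField K]
    (hK : IsImaginaryQuadratic K) (hH : SatisfiesHeegnerHypothesis N K) (hd : NumberField.discr K < -4)
    (H : HeegnerDatum N (NumberField.discr K)) (ι : K →+* ℂ) (P : (W.baseChange K).toAffine.Point)
    (hP : WeierstrassCurve.Affine.Point.map ι.toRatAlgHom P = heegnerPointComplex D H) (hP' : ¬ IsOfFinAddOrder P)
    (𝔭 : HeightOneSpectrum (𝓞 K)) (h𝔭 : ((3 : ℕ) : 𝓞 K) ∈ 𝔭.asIdeal)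
    (he : 𝔭.asIdeal.ramificationIdx (𝓞 ℚ) = 1) (hf : 𝔭.asIdeal.inertiaDeg (𝓞 ℚ) = 1)
    (hSha : Nat.card (AddCommGroup.primaryComponent (W.baseChange K).sha 3) = 1)
    (hlog : padicLogOrd W 3 (embAt K 3 𝔭 h𝔭 he hf) P = padicValNat 3 (AddSubgroup.zmultiples P).index) :
    Nat.card (selmerAcBase (W.baseChange K) 3 𝔭 ∅) = 1 := by
  obtain ⟨a, ⟨_, hcard⟩, ha⟩ := h W hA hj hf₂ hs ht D K hK hH hd H ι P hP hP' 𝔭 h𝔭 he hf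
  rw [hSha, hlog] at ha
  simp only [padicValNat_one_right, Nat.cast_zero, sub_self, mul_zero, add_zero, Nat.cast_eq_zero] at ha
  rw [hcard, ha, pow_zero]

/-! ## §2c KL3-M — chain step (iii): residual-Selmer MATCHING of mod-3 companions (Galois cohomology)

Why the base Selmer groups of two mod-3 congruent curves vanish together. For `X ∈ {W, G}` with `X(K)[3] = 0`
(`ρ̄` irreducible) the map `H¹(K, X[3]) → H¹(K, X[3^∞])[3]` is an isomorphism; a residual class lands in
`Sel_𝔭(K, X[3^∞])` iff locally it lies in the kernels `X(K_w)[3^∞]/3 ⊆ H¹(K_w, X[3])`, groups of order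
`#H⁰(K_w, ρ̄)` — the SAME number for `W` and `G` since `W[3] ≅ G[3] =: ρ̄`. Under `H⁰(ℚ₃, ρ̄) = 0` and
`H⁰(ℚ_ℓ, ρ̄) = 0` at every `ℓ ≠ 3` dividing `N_W N_G` (all split in `K`, so `K_w = ℚ_ℓ`; for `ℓ ≠ 3` and self-dual
`ρ̄` this is `H¹(ℚ_ℓ, ρ̄) = 0`, `NoLocalThreeTorsionAt`'s docstring) the induced residual conditions are: STRICT at
`𝔭` and at every `w ∣ N_W N_G`, NONE at `𝔭̄`, UNRAMIFIED (= the Kummer image `X(K_w)/3 = H¹_ur` at a good `w ∤ 3`)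
elsewhere — conditions on `ρ̄` ALONE, blind to the reduction types of `W` and `G` (in particular to `W` being
additive and `G` good at 3). Hence `Sel_𝔭(K, W[3^∞])[3] ≅ Sel(K, ρ̄) ≅ Sel_𝔭(K, G[3^∞])[3]`, and a `3`-primary
group vanishes iff its `3`-torsion does. -/

/-- **KL3-M `ResidualSelmerMatchingThree` (THEOREM-CANDIDATE; pure Galois cohomology as in the section
docstring; consumed as a hypothesis, never a named fact).** For `W, G/ℚ` with `ρ̄_{W,3}` surjective and
`a_ℓ(W) ≡ a_ℓ(G) (mod 3)` at every prime `ℓ ∤ 3N_W N_G` (so `W[3] ≅ G[3]` by Brauer–Nesbitt–Chebotarev and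
irreducibility), no `ℚ₃`-rational and no `ℚ_ℓ`-rational 3-torsion at the primes `ℓ ≠ 3` of `N_W N_G`, and `K`
imaginary quadratic in which every prime of `N_W N_G` splits: at every prime `𝔭 ∣ 3` of `K`, Castella's base
Selmer groups `Sel_𝔭(K, W[3^∞])` and `Sel_𝔭(K, G[3^∞])` (`X11b.AcSelmer.selmerAcBase`) are trivial together.
[cite: KrizLi2019, §1.4 (the mod-p^m setting; the matching itself is folklore Galois cohomology)] -/
def ResidualSelmerMatchingThree : Prop :=
  ∀ (W G : WeierstrassCurve ℚ) [W.IsElliptic] [W.IsGloballyMinimal] [G.IsElliptic] [G.IsGloballyMinimal],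
    W.HasSurjectiveModNGaloisRep 3 →
    (∀ ℓ : ℕ, ℓ.Prime → ¬ (ℓ ∣ 3 * W.conductorNorm ℤ * G.conductorNorm ℤ) →
      ((W.LFunction ℓ : ℤ) : ZMod 3) = ((G.LFunction ℓ : ℤ) : ZMod 3)) →
    NoLocalThreeTorsionAt W 3 →
    (∀ (ℓ : ℕ) [Fact ℓ.Prime], ℓ ≠ 3 → (ℓ : ℤ) ∣ W.conductorNorm ℤ * G.conductorNorm ℤ →
      NoLocalThreeTorsionAt W ℓ) →
    ∀ (K : Type) [Field K] [NumberField K], IsImaginaryQuadratic K →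
      SatisfiesHeegnerHypothesis (W.conductorNorm ℤ * G.conductorNorm ℤ) K →
      ∀ (𝔭 : HeightOneSpectrum (𝓞 K)), ((3 : ℕ) : 𝓞 K) ∈ 𝔭.asIdeal →
        (Nat.card (selmerAcBase (W.baseChange K) 3 𝔭 ∅) = 1 ↔
          Nat.card (selmerAcBase (G.baseChange K) 3 𝔭 ∅) = 1)

/-! ## §2d Bookkeeping for the assembly (item L2 of the ASSEMBLY-TODO): the Euler-type exponent vanishes under the unit hypotheses -/

/-- At the additive prime: `a₃(W) = 0` and `W` not good at `3` give `|W̃^{ns}(𝔽₃)| = 3`. -/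
theorem nsCount_three_of_additive (W : WeierstrassCurve ℚ) [W.IsElliptic]
    (hbad : ¬ W.HasGoodReductionAtPrime 3) (ha3 : W.LFunction 3 = 0) : nsCount W 3 = 3 := by
  unfold nsCount
  rw [dif_pos Nat.prime_three]
  have : ¬ (haveI := Fact.mk Nat.prime_three; W.HasGoodReductionAtPrime 3) := hbad
  simp [this, ha3]

/-- `ord₃ 3 = 1`, so the `ℓ = 3` summand of `klExponent` is `0` for an additive `W` with `a₃ = 0`. -/
theorem padicValInt_nsCount_three_of_additive (W : WeierstrassCurve ℚ) [W.IsElliptic]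
    (hbad : ¬ W.HasGoodReductionAtPrime 3) (ha3 : W.LFunction 3 = 0) :
    padicValInt 3 (nsCount W 3) = 1 := by
  rw [nsCount_three_of_additive W hbad ha3]
  have h : padicValInt 3 ((3 : ℕ) : ℤ) = 1 := by
    rw [padicValInt.of_nat]; exact padicValNat_self
  simpa using h

/-- **L2.** If the `ℓ = 3` factor has `ord₃ = 1` (additive `W`, `a₃ = 0`: the lemma above) and every other
depleted factor `|W̃^{ns}(𝔽_ℓ)|`, `ℓ ∈ klSet W G ∖ {3}`, is a `3`-adic unit, then `U_W = klExponent W G = 0`. -/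
theorem klExponent_eq_zero_of_units (W G : WeierstrassCurve ℚ) [W.IsElliptic] [G.IsElliptic]
    (h3 : padicValInt 3 (nsCount W 3) = 1)
    (hℓ : ∀ ℓ ∈ klSet W G, ℓ ≠ 3 → padicValInt 3 (nsCount W ℓ) = 0) :
    klExponent W G = 0 := by
  unfold klExponent
  refine Finset.sum_eq_zero fun ℓ hℓmem => ?_
  by_cases h : ℓ = 3
  · subst h; simp [h3]
  · simp [h, hℓ ℓ hℓmem h]

/-- The prime `3` always lies in the depletion set (the factor `p` of `pNN′/M`). -/
theorem three_mem_klSet (W G : WeierstrassCurve ℚ) [W.IsElliptic] [G.IsElliptic]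
    (hW : W.conductorNorm ℤ ≠ 0) (hG : G.conductorNorm ℤ ≠ 0) : 3 ∈ klSet W G := by
  unfold klSet
  simp only [Finset.mem_filter, Nat.mem_primeFactors]
  refine ⟨⟨Nat.prime_three, dvd_mul_of_dvd_left (dvd_mul_right 3 _) _, ?_⟩, by simp⟩
  exact mul_ne_zero (mul_ne_zero (by norm_num) hW) hG

/-- With `3 ∈ klSet` and every other depleted factor a `3`-adic unit, `U_X = ord₃ |X̃^{ns}(𝔽₃)| − 1`
(for `X` good at `3`: `ord₃ (4 − a₃(X)) − 1 ∈ {−1, 0}`, Kriz–Li Rem. 1.17). -/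
theorem klExponent_eq_of_offThree_units (X Y : WeierstrassCurve ℚ) [X.IsElliptic] [Y.IsElliptic]
    (h3 : 3 ∈ klSet X Y) (hℓ : ∀ ℓ ∈ klSet X Y, ℓ ≠ 3 → padicValInt 3 (nsCount X ℓ) = 0) :
    klExponent X Y = padicValInt 3 (nsCount X 3) - 1 := by
  unfold klExponent
  rw [← Finset.add_sum_erase _ _ h3]
  have hrest : ∑ ℓ ∈ (klSet X Y).erase 3,
      (padicValInt 3 (nsCount X ℓ) - if ℓ = 3 then (1 : ℤ) else 0) = 0 :=
    Finset.sum_eq_zero fun ℓ hmem => by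
      have hne : ℓ ≠ 3 := Finset.ne_of_mem_erase hmem
      simp [hne, hℓ ℓ (Finset.mem_of_mem_erase hmem) hne]
  rw [hrest]; simp

end Summit.BirchSwinnertonDyer.Rank1Residual.O5.HeegnerLogTransport

end
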